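import Mathlib

/-!
# Route `SymPencil` — inner rank of the `2 | 2` row split of `per_4`: the side patterns of the
# five cone dichotomies (`--supports` stmt-ValiantsHypothesis-5674 `SdcSuperquadratic`; (8,8) column,
# isotropic-kernel route, bridge step (B1) of memo `NOTE-p6g15-5674-IR12-reduction.md` §8)

The five dichotomies of `SymPencilPerFourInnerRankIsotropicCone.cone_dichotomies_diag` choose, for
each of the indices `0,1,2,3` and the coordinate sum, the `y₂`-side or the `y₃`-side functional.
This file turns the `32` side patterns into six shapes: one-sided (`W ≤ K⁴ ⊕ 0` or
`W ≤ 0 ⊕ K⁴`, by four small linear computations in the degenerate patterns) or one of the four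
mixed patterns with explicit pairwise distinct indices (to be normalised by a coordinate
permutation and fed to `SymPencilPerFourInnerRankSlotTypes`, then to the mixed kills).  Honest
framing: bookkeeping in a conditional reduction of the cells `(8,8,10)`, `(8,8,11)`; nothing about
the window, the crux or `VP ≠ VNP`.  No definitions, no named facts. [folklore]
-/

noncomputable section

-- single-conjunct layout: Sub = Summit, duplicated namespace component intended
set_option linter.dupNamespace false

namespace Summit.ValiantsHypothesis.ValiantsHypothesis.Theorems.SymPencilPerFourInnerRankSlotPattern

variable {K : Type*} [Field K] [CharZero K]

/-- **Side patterns of the five cone dichotomies.**  Given, for a subspace `W ≤ K⁴ × K⁴` and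
`a` with non-zero coordinates, the five dichotomies of
`SymPencilPerFourInnerRankIsotropicCone.cone_dichotomies_diag` (hypotheses `hA`, `hB`), one of six
shapes holds: `W ≤ K⁴ ⊕ 0`, `W ≤ 0 ⊕ K⁴`, or one of the four mixed side patterns (type I, type I
mirrored, type II, type II mirrored) with explicit pairwise distinct indices.  (Pure case
distinction plus four small linear computations; the mixed patterns are then normalised by a
coordinate permutation and fed to `SymPencilPerFourInnerRankSlotTypes`.) [folklore] -/
theorem pattern_cases (a : Fin 4 → K) (ha : ∀ i, a i ≠ 0)
    (W : Submodule K ((Fin 4 → K) × (Fin 4 → K)))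
    (hA : (∀ w ∈ W, w.1 0 / a 0 + w.1 1 / a 1 + w.1 2 / a 2 + w.1 3 / a 3 = 0) ∨
      (∀ w ∈ W, w.2 0 / a 0 + w.2 1 / a 1 + w.2 2 / a 2 + w.2 3 / a 3 = 0))
    (hB : ∀ l : Fin 4,
      (∀ w ∈ W, 2 * (w.1 l / a l) = w.1 0 / a 0 + w.1 1 / a 1 + w.1 2 / a 2 + w.1 3 / a 3) ∨
      (∀ w ∈ W, 2 * (w.2 l / a l) = w.2 0 / a 0 + w.2 1 / a 1 + w.2 2 / a 2 + w.2 3 / a 3)) :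
    (∀ w ∈ W, w.2 = 0) ∨ (∀ w ∈ W, w.1 = 0) ∨
    (∃ c d p q : Fin 4, c ≠ d ∧ c ≠ p ∧ c ≠ q ∧ d ≠ p ∧ d ≠ q ∧ p ≠ q ∧
      (∀ w ∈ W, 2 * (w.1 c / a c) = w.1 0 / a 0 + w.1 1 / a 1 + w.1 2 / a 2 + w.1 3 / a 3) ∧
      (∀ w ∈ W, 2 * (w.1 d / a d) = w.1 0 / a 0 + w.1 1 / a 1 + w.1 2 / a 2 + w.1 3 / a 3) ∧
      (∀ w ∈ W, 2 * (w.2 p / a p) = w.2 0 / a 0 + w.2 1 / a 1 + w.2 2 / a 2 + w.2 3 / a 3) ∧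
      (∀ w ∈ W, 2 * (w.2 q / a q) = w.2 0 / a 0 + w.2 1 / a 1 + w.2 2 / a 2 + w.2 3 / a 3) ∧
      (∀ w ∈ W, w.2 0 / a 0 + w.2 1 / a 1 + w.2 2 / a 2 + w.2 3 / a 3 = 0)) ∨
    (∃ c d p q : Fin 4, c ≠ d ∧ c ≠ p ∧ c ≠ q ∧ d ≠ p ∧ d ≠ q ∧ p ≠ q ∧
      (∀ w ∈ W, 2 * (w.2 c / a c) = w.2 0 / a 0 + w.2 1 / a 1 + w.2 2 / a 2 + w.2 3 / a 3) ∧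
      (∀ w ∈ W, 2 * (w.2 d / a d) = w.2 0 / a 0 + w.2 1 / a 1 + w.2 2 / a 2 + w.2 3 / a 3) ∧
      (∀ w ∈ W, 2 * (w.1 p / a p) = w.1 0 / a 0 + w.1 1 / a 1 + w.1 2 / a 2 + w.1 3 / a 3) ∧
      (∀ w ∈ W, 2 * (w.1 q / a q) = w.1 0 / a 0 + w.1 1 / a 1 + w.1 2 / a 2 + w.1 3 / a 3) ∧
      (∀ w ∈ W, w.1 0 / a 0 + w.1 1 / a 1 + w.1 2 / a 2 + w.1 3 / a 3 = 0)) ∨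
    (∃ d p q c : Fin 4, d ≠ p ∧ d ≠ q ∧ d ≠ c ∧ p ≠ q ∧ p ≠ c ∧ q ≠ c ∧
      (∀ w ∈ W, 2 * (w.1 d / a d) = w.1 0 / a 0 + w.1 1 / a 1 + w.1 2 / a 2 + w.1 3 / a 3) ∧
      (∀ w ∈ W, w.1 0 / a 0 + w.1 1 / a 1 + w.1 2 / a 2 + w.1 3 / a 3 = 0) ∧
      (∀ w ∈ W, 2 * (w.2 p / a p) = w.2 0 / a 0 + w.2 1 / a 1 + w.2 2 / a 2 + w.2 3 / a 3) ∧
      (∀ w ∈ W, 2 * (w.2 q / a q) = w.2 0 / a 0 + w.2 1 / a 1 + w.2 2 / a 2 + w.2 3 / a 3) ∧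
      (∀ w ∈ W, 2 * (w.2 c / a c) = w.2 0 / a 0 + w.2 1 / a 1 + w.2 2 / a 2 + w.2 3 / a 3)) ∨
    (∃ d p q c : Fin 4, d ≠ p ∧ d ≠ q ∧ d ≠ c ∧ p ≠ q ∧ p ≠ c ∧ q ≠ c ∧
      (∀ w ∈ W, 2 * (w.2 d / a d) = w.2 0 / a 0 + w.2 1 / a 1 + w.2 2 / a 2 + w.2 3 / a 3) ∧
      (∀ w ∈ W, w.2 0 / a 0 + w.2 1 / a 1 + w.2 2 / a 2 + w.2 3 / a 3 = 0) ∧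
      (∀ w ∈ W, 2 * (w.1 p / a p) = w.1 0 / a 0 + w.1 1 / a 1 + w.1 2 / a 2 + w.1 3 / a 3) ∧
      (∀ w ∈ W, 2 * (w.1 q / a q) = w.1 0 / a 0 + w.1 1 / a 1 + w.1 2 / a 2 + w.1 3 / a 3) ∧
      (∀ w ∈ W, 2 * (w.1 c / a c) = w.1 0 / a 0 + w.1 1 / a 1 + w.1 2 / a 2 + w.1 3 / a 3)) := by
  have h0' := ha 0; have h1' := ha 1; have h2' := ha 2; have h3' := ha 3
  rcases hA with hS | hS <;> rcases hB 0 with h0 | h0 <;> rcases hB 1 with h1 | h1 <;>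
    rcases hB 2 with h2 | h2 <;> rcases hB 3 with h3 | h3
  · right; left
    intro w hw
    have y0 : w.1 0 / a 0 = 0 := by linear_combination h0 w hw / 2 + hS w hw / 2
    have y1 : w.1 1 / a 1 = 0 := by linear_combination h1 w hw / 2 + hS w hw / 2
    have y2 : w.1 2 / a 2 = 0 := by linear_combination h2 w hw / 2 + hS w hw / 2
    have y3 : w.1 3 / a 3 = 0 := by linear_combination h3 w hw / 2 + hS w hw / 2
    funext i; fin_cases i
    · exact (div_eq_zero_iff.1 y0).resolve_right h0'
    · exact (div_eq_zero_iff.1 y1).resolve_right h1'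
    · exact (div_eq_zero_iff.1 y2).resolve_right h2'
    · exact (div_eq_zero_iff.1 y3).resolve_right h3'
  · right; left
    intro w hw
    have y0 : w.1 0 / a 0 = 0 := by linear_combination h0 w hw / 2 + hS w hw / 2
    have y1 : w.1 1 / a 1 = 0 := by linear_combination h1 w hw / 2 + hS w hw / 2
    have y2 : w.1 2 / a 2 = 0 := by linear_combination h2 w hw / 2 + hS w hw / 2
    have y3 : w.1 3 / a 3 = 0 := by linear_combination hS w hw - y0 - y1 - y2
    funext i; fin_cases i
    · exact (div_eq_zero_iff.1 y0).resolve_right h0'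
    · exact (div_eq_zero_iff.1 y1).resolve_right h1'
    · exact (div_eq_zero_iff.1 y2).resolve_right h2'
    · exact (div_eq_zero_iff.1 y3).resolve_right h3'
  · right; left
    intro w hw
    have y0 : w.1 0 / a 0 = 0 := by linear_combination h0 w hw / 2 + hS w hw / 2
    have y1 : w.1 1 / a 1 = 0 := by linear_combination h1 w hw / 2 + hS w hw / 2
    have y3 : w.1 3 / a 3 = 0 := by linear_combination h3 w hw / 2 + hS w hw / 2
    have y2 : w.1 2 / a 2 = 0 := by linear_combination hS w hw - y0 - y1 - y3
    funext i; fin_cases i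
    · exact (div_eq_zero_iff.1 y0).resolve_right h0'
    · exact (div_eq_zero_iff.1 y1).resolve_right h1'
    · exact (div_eq_zero_iff.1 y2).resolve_right h2'
    · exact (div_eq_zero_iff.1 y3).resolve_right h3'
  · right; right; right; left
    exact ⟨2, 3, 0, 1, by decide, by decide, by decide, by decide, by decide, by decide, h2, h3, h0, h1, hS⟩
  · right; left
    intro w hw
    have y0 : w.1 0 / a 0 = 0 := by linear_combination h0 w hw / 2 + hS w hw / 2
    have y2 : w.1 2 / a 2 = 0 := by linear_combination h2 w hw / 2 + hS w hw / 2
    have y3 : w.1 3 / a 3 = 0 := by linear_combination h3 w hw / 2 + hS w hw / 2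
    have y1 : w.1 1 / a 1 = 0 := by linear_combination hS w hw - y0 - y2 - y3
    funext i; fin_cases i
    · exact (div_eq_zero_iff.1 y0).resolve_right h0'
    · exact (div_eq_zero_iff.1 y1).resolve_right h1'
    · exact (div_eq_zero_iff.1 y2).resolve_right h2'
    · exact (div_eq_zero_iff.1 y3).resolve_right h3'
  · right; right; right; left
    exact ⟨1, 3, 0, 2, by decide, by decide, by decide, by decide, by decide, by decide, h1, h3, h0, h2, hS⟩
  · right; right; right; left
    exact ⟨1, 2, 0, 3, by decide, by decide, by decide, by decide, by decide, by decide, h1, h2, h0, h3, hS⟩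
  · right; right; right; right; left
    exact ⟨0, 1, 2, 3, by decide, by decide, by decide, by decide, by decide, by decide, h0, hS, h1, h2, h3⟩
  · right; left
    intro w hw
    have y1 : w.1 1 / a 1 = 0 := by linear_combination h1 w hw / 2 + hS w hw / 2
    have y2 : w.1 2 / a 2 = 0 := by linear_combination h2 w hw / 2 + hS w hw / 2
    have y3 : w.1 3 / a 3 = 0 := by linear_combination h3 w hw / 2 + hS w hw / 2
    have y0 : w.1 0 / a 0 = 0 := by linear_combination hS w hw - y1 - y2 - y3
    funext i; fin_cases i
    · exact (div_eq_zero_iff.1 y0).resolve_right h0'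
    · exact (div_eq_zero_iff.1 y1).resolve_right h1'
    · exact (div_eq_zero_iff.1 y2).resolve_right h2'
    · exact (div_eq_zero_iff.1 y3).resolve_right h3'
  · right; right; right; left
    exact ⟨0, 3, 1, 2, by decide, by decide, by decide, by decide, by decide, by decide, h0, h3, h1, h2, hS⟩
  · right; right; right; left
    exact ⟨0, 2, 1, 3, by decide, by decide, by decide, by decide, by decide, by decide, h0, h2, h1, h3, hS⟩
  · right; right; right; right; left
    exact ⟨1, 0, 2, 3, by decide, by decide, by decide, by decide, by decide, by decide, h1, hS, h0, h2, h3⟩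
  · right; right; right; left
    exact ⟨0, 1, 2, 3, by decide, by decide, by decide, by decide, by decide, by decide, h0, h1, h2, h3, hS⟩
  · right; right; right; right; left
    exact ⟨2, 0, 1, 3, by decide, by decide, by decide, by decide, by decide, by decide, h2, hS, h0, h1, h3⟩
  · right; right; right; right; left
    exact ⟨3, 0, 1, 2, by decide, by decide, by decide, by decide, by decide, by decide, h3, hS, h0, h1, h2⟩
  · left
    intro w hw
    have hS0 : w.2 0 / a 0 + w.2 1 / a 1 + w.2 2 / a 2 + w.2 3 / a 3 = 0 := by
      linear_combination -(h0 w hw + h1 w hw + h2 w hw + h3 w hw) / 2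
    have z0 : w.2 0 / a 0 = 0 := by linear_combination h0 w hw / 2 + hS0 / 2
    have z1 : w.2 1 / a 1 = 0 := by linear_combination h1 w hw / 2 + hS0 / 2
    have z2 : w.2 2 / a 2 = 0 := by linear_combination h2 w hw / 2 + hS0 / 2
    have z3 : w.2 3 / a 3 = 0 := by linear_combination h3 w hw / 2 + hS0 / 2
    funext i; fin_cases i
    · exact (div_eq_zero_iff.1 z0).resolve_right h0'
    · exact (div_eq_zero_iff.1 z1).resolve_right h1'
    · exact (div_eq_zero_iff.1 z2).resolve_right h2'
    · exact (div_eq_zero_iff.1 z3).resolve_right h3'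
  · right; left
    intro w hw
    have hS0 : w.1 0 / a 0 + w.1 1 / a 1 + w.1 2 / a 2 + w.1 3 / a 3 = 0 := by
      linear_combination -(h0 w hw + h1 w hw + h2 w hw + h3 w hw) / 2
    have y0 : w.1 0 / a 0 = 0 := by linear_combination h0 w hw / 2 + hS0 / 2
    have y1 : w.1 1 / a 1 = 0 := by linear_combination h1 w hw / 2 + hS0 / 2
    have y2 : w.1 2 / a 2 = 0 := by linear_combination h2 w hw / 2 + hS0 / 2
    have y3 : w.1 3 / a 3 = 0 := by linear_combination h3 w hw / 2 + hS0 / 2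
    funext i; fin_cases i
    · exact (div_eq_zero_iff.1 y0).resolve_right h0'
    · exact (div_eq_zero_iff.1 y1).resolve_right h1'
    · exact (div_eq_zero_iff.1 y2).resolve_right h2'
    · exact (div_eq_zero_iff.1 y3).resolve_right h3'
  · right; right; right; right; right
    exact ⟨3, 0, 1, 2, by decide, by decide, by decide, by decide, by decide, by decide, h3, hS, h0, h1, h2⟩
  · right; right; right; right; right
    exact ⟨2, 0, 1, 3, by decide, by decide, by decide, by decide, by decide, by decide, h2, hS, h0, h1, h3⟩
  · right; right; left
    exact ⟨0, 1, 2, 3, by decide, by decide, by decide, by decide, by decide, by decide, h0, h1, h2, h3, hS⟩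
  · right; right; right; right; right
    exact ⟨1, 0, 2, 3, by decide, by decide, by decide, by decide, by decide, by decide, h1, hS, h0, h2, h3⟩
  · right; right; left
    exact ⟨0, 2, 1, 3, by decide, by decide, by decide, by decide, by decide, by decide, h0, h2, h1, h3, hS⟩
  · right; right; left
    exact ⟨0, 3, 1, 2, by decide, by decide, by decide, by decide, by decide, by decide, h0, h3, h1, h2, hS⟩
  · left
    intro w hw
    have z1 : w.2 1 / a 1 = 0 := by linear_combination h1 w hw / 2 + hS w hw / 2
    have z2 : w.2 2 / a 2 = 0 := by linear_combination h2 w hw / 2 + hS w hw / 2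
    have z3 : w.2 3 / a 3 = 0 := by linear_combination h3 w hw / 2 + hS w hw / 2
    have z0 : w.2 0 / a 0 = 0 := by linear_combination hS w hw - z1 - z2 - z3
    funext i; fin_cases i
    · exact (div_eq_zero_iff.1 z0).resolve_right h0'
    · exact (div_eq_zero_iff.1 z1).resolve_right h1'
    · exact (div_eq_zero_iff.1 z2).resolve_right h2'
    · exact (div_eq_zero_iff.1 z3).resolve_right h3'
  · right; right; right; right; right
    exact ⟨0, 1, 2, 3, by decide, by decide, by decide, by decide, by decide, by decide, h0, hS, h1, h2, h3⟩
  · right; right; left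
    exact ⟨1, 2, 0, 3, by decide, by decide, by decide, by decide, by decide, by decide, h1, h2, h0, h3, hS⟩
  · right; right; left
    exact ⟨1, 3, 0, 2, by decide, by decide, by decide, by decide, by decide, by decide, h1, h3, h0, h2, hS⟩
  · left
    intro w hw
    have z0 : w.2 0 / a 0 = 0 := by linear_combination h0 w hw / 2 + hS w hw / 2
    have z2 : w.2 2 / a 2 = 0 := by linear_combination h2 w hw / 2 + hS w hw / 2
    have z3 : w.2 3 / a 3 = 0 := by linear_combination h3 w hw / 2 + hS w hw / 2
    have z1 : w.2 1 / a 1 = 0 := by linear_combination hS w hw - z0 - z2 - z3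
    funext i; fin_cases i
    · exact (div_eq_zero_iff.1 z0).resolve_right h0'
    · exact (div_eq_zero_iff.1 z1).resolve_right h1'
    · exact (div_eq_zero_iff.1 z2).resolve_right h2'
    · exact (div_eq_zero_iff.1 z3).resolve_right h3'
  · right; right; left
    exact ⟨2, 3, 0, 1, by decide, by decide, by decide, by decide, by decide, by decide, h2, h3, h0, h1, hS⟩
  · left
    intro w hw
    have z0 : w.2 0 / a 0 = 0 := by linear_combination h0 w hw / 2 + hS w hw / 2
    have z1 : w.2 1 / a 1 = 0 := by linear_combination h1 w hw / 2 + hS w hw / 2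
    have z3 : w.2 3 / a 3 = 0 := by linear_combination h3 w hw / 2 + hS w hw / 2
    have z2 : w.2 2 / a 2 = 0 := by linear_combination hS w hw - z0 - z1 - z3
    funext i; fin_cases i
    · exact (div_eq_zero_iff.1 z0).resolve_right h0'
    · exact (div_eq_zero_iff.1 z1).resolve_right h1'
    · exact (div_eq_zero_iff.1 z2).resolve_right h2'
    · exact (div_eq_zero_iff.1 z3).resolve_right h3'
  · left
    intro w hw
    have z0 : w.2 0 / a 0 = 0 := by linear_combination h0 w hw / 2 + hS w hw / 2
    have z1 : w.2 1 / a 1 = 0 := by linear_combination h1 w hw / 2 + hS w hw / 2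
    have z2 : w.2 2 / a 2 = 0 := by linear_combination h2 w hw / 2 + hS w hw / 2
    have z3 : w.2 3 / a 3 = 0 := by linear_combination hS w hw - z0 - z1 - z2
    funext i; fin_cases i
    · exact (div_eq_zero_iff.1 z0).resolve_right h0'
    · exact (div_eq_zero_iff.1 z1).resolve_right h1'
    · exact (div_eq_zero_iff.1 z2).resolve_right h2'
    · exact (div_eq_zero_iff.1 z3).resolve_right h3'
  · left
    intro w hw
    have z0 : w.2 0 / a 0 = 0 := by linear_combination h0 w hw / 2 + hS w hw / 2
    have z1 : w.2 1 / a 1 = 0 := by linear_combination h1 w hw / 2 + hS w hw / 2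
    have z2 : w.2 2 / a 2 = 0 := by linear_combination h2 w hw / 2 + hS w hw / 2
    have z3 : w.2 3 / a 3 = 0 := by linear_combination h3 w hw / 2 + hS w hw / 2
    funext i; fin_cases i
    · exact (div_eq_zero_iff.1 z0).resolve_right h0'
    · exact (div_eq_zero_iff.1 z1).resolve_right h1'
    · exact (div_eq_zero_iff.1 z2).resolve_right h2'
    · exact (div_eq_zero_iff.1 z3).resolve_right h3'

end Summit.ValiantsHypothesis.ValiantsHypothesis.Theorems.SymPencilPerFourInnerRankSlotPattern

end
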